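import Summits.KontsevichZagierPeriods.Zeta5Search.SymRayBasics
import Summits.KontsevichZagierPeriods.Zeta5Search.SymRayGosper
import HarnessLib

/-!
# Zudilin's recursion (8) for the canonical coefficients on the symmetric ray (cell `pub-zeta5`, P1)

HONEST FRAMING: systematic search; no irrationality claim unless certified.

OUR work (Summit side), P1 seat generation 3. TRANSFER of the kernel-certified creative-telescoping identity of the ray
(`SymRayGosper.gosper_symray`: `(Σ_i P_i N_i)·B = g(·,t+1)·A − g·B`) to the canonical coefficients of the wedge dictionary:
for `X ∈ {U, W, V}` (`WedgeDictionary.coeffU/W/V`) and `b_m = bRay m = (3m;m⁷)`,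

  `P₃(n) X(b_{n+3}) + P₂(n) X(b_{n+2}) + P₁(n) X(b_{n+1}) + P₀(n) X(b_n) = 0`   for all `n`   (`ray_recurrence`),

`P_i = ev1 symP_i` — Zudilin's third-order recursion (8) of Mat. Zametki 2002 in the gauge `U = (2/n!⁴)u` (the first claim of his
Theorem 2, there obtained by Zeilberger's algorithm, here a THEOREM for our canonical `U, W` AND the constant term `V`).
Steps: (1) Pochhammer bookkeeping puts the four summands `R_{n+i}` and the certificate `G = g·R_n/D` over the common factor
`R̄ = (t+1)_n(t+2n+2)_n/((t+n+1)_{n+1}⁶ ((t+2n+2)⋯(t+2n+8))⁷ (t+1))` (`term0 … term3`, `termG`, `termG_succ`); (2) the rational identity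
`Σ_i P_i R_{n+i}(t) + G(t) − G(t+1) = 0` at natural `t` (`rec_identity_ray`); (3) partial fractions of `G` EXIST with lattice poles of
order `≤ 7` (`exists_pf_G`: `G·((t+1)_{3n+7})⁷` is a polynomial of degree `≤ 17n+46`); (4) uniqueness of partial fractions makes the
combined data vanish, hence every order sum (`U`: order 5, `W`: order 3) and — because `g(n,0) = 0`, i.e. `G(0) = 0` — also the
constant-term functional `V` (`Vfun_shiftUp`) satisfy the recursion.
-/

noncomputable section

open Finset Polynomial

namespace Summit.KontsevichZagierPeriods.Zeta5Search.SymRay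

open Summit.KontsevichZagierPeriods.Zeta5Search.DualSeries
open Summit.KontsevichZagierPeriods.Zeta5Search.WedgeDictionary
open Summit.KontsevichZagierPeriods.Zeta5Search.PolyReflect
open Literature.NumberTheory.Transcendental
open Literature.NumberTheory.Transcendental.BallRivoal (pfEval pf_unique poch_pos harm pochPoly eval_pochPoly)
open Literature.NumberTheory.Irrationality.CressonFischlerRivoal2008 (exists_pf_data)

/-! ### The certificate `G` as a polynomial over the lattice denominator -/

/-- `G·((t+1)_{3n+7})⁷ = g(n,t)·(t+1)_n⁸ (t+2n+2)_n (t+n+1)_{n+1} (t+2n+8)_n⁷` as a polynomial in `t`. -/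
def gPolyT (n : ℕ) : ℚ[X] :=
  toPolyT symG n * (pochPoly 1 n ^ 8 * pochPoly (2 * n + 2) n * pochPoly (n + 1) (n + 1) * pochPoly (2 * n + 8) n ^ 7)

/-- Evaluation of `gPolyT`. -/
theorem eval_gPolyT (n : ℕ) (t : ℚ) : (gPolyT n).eval t =
    ev2 symG n t * (BallRivoal.poch (t + 1) n ^ 8 * BallRivoal.poch (t + (2 * n + 2)) n *
      BallRivoal.poch (t + (n + 1)) (n + 1) * BallRivoal.poch (t + (2 * n + 8)) n ^ 7) := by
  simp only [gPolyT, eval_mul, eval_pow, eval_toPolyT, eval_pochPoly]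

/-- `symG` has `45` rows. -/
theorem symG_length : symG.length = 45 := by decide

/-- `deg gPolyT ≤ 17n + 46 (< 7(3n+7))`. -/
theorem natDegree_gPolyT_le (n : ℕ) : (gPolyT n).natDegree ≤ 17 * n + 46 := by
  unfold gPolyT
  have h0 := natDegree_toPolyT_le symG (n : ℚ)
  rw [symG_length] at h0
  have h1 := natDegree_pochPoly_le (1 : ℚ) n
  have h2 := natDegree_pochPoly_le ((2 * n + 2 : ℕ) : ℚ) n
  have h3 := natDegree_pochPoly_le ((n + 1 : ℕ) : ℚ) (n + 1)
  have h4 := natDegree_pochPoly_le ((2 * n + 8 : ℕ) : ℚ) n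
  have e1 : (pochPoly 1 n ^ 8).natDegree ≤ 8 * n := natDegree_pow_le.trans (by omega)
  have e4 : (pochPoly ((2 * n + 8 : ℕ) : ℚ) n ^ 7).natDegree ≤ 7 * n := natDegree_pow_le.trans (by omega)
  push_cast at h2 h3 h4 e4
  refine natDegree_mul_le.trans ?_
  have e5 := natDegree_mul_le (p := pochPoly 1 n ^ 8 * pochPoly (2 * n + 2) n * pochPoly (n + 1) (n + 1))
    (q := pochPoly (2 * (n : ℚ) + 8) n ^ 7)
  have e6 := natDegree_mul_le (p := pochPoly 1 n ^ 8 * pochPoly (2 * (n : ℚ) + 2) n) (q := pochPoly ((n : ℚ) + 1) (n + 1))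
  have e7 := natDegree_mul_le (p := pochPoly (1 : ℚ) n ^ 8) (q := pochPoly (2 * (n : ℚ) + 2) n)
  omega

/-- **Partial fractions of the certificate exist** (lattice poles `−1, …, −(3n+7)` of order `≤ 7`). -/
theorem exists_pf_G (n : ℕ) : ∃ d : ℕ → ℕ → ℚ, ∀ t : ℚ, (∀ p, p ≤ 3 * n + 6 → t + p + 1 ≠ 0) →
    pfEval (3 * n + 6) 7 d t = (gPolyT n).eval t / BallRivoal.poch (t + 1) (3 * n + 7) ^ 7 := by
  have hdeg : (gPolyT n).degree < ((7 * (3 * n + 6 + 1) : ℕ) : WithBot ℕ) :=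
    (degree_le_of_natDegree_le (natDegree_gPolyT_le n)).trans_lt (by exact_mod_cast (by omega))
  obtain ⟨d, hd⟩ := exists_pf_data (3 * n + 6) 7 (by norm_num) (gPolyT n) hdeg
  exact ⟨d, fun t ht => by rw [hd t ht]⟩

/-- `g(n,0) = 0`: the row `t^0` of the certificate is zero, so `G(0) = 0`. -/
theorem ev2_symG_zero (n : ℚ) : ev2 symG n 0 = 0 := by
  rw [show symG = [0] :: (gCertA.tail ++ gCertB) from rfl, ev2_cons]
  simp

/-! ### Pochhammer bookkeeping on the ray (atoms: `(t+1)_n, (t+2n+2)_n, (t+n+1)_{n+1}` and linear forms `ev2 (lin2 a b c)`) -/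

section bookkeeping
variable (n t : ℚ)

/-- `t+n+1`. -/
private theorem l111 : ev2 (lin2 1 1 1) n t = t + n + 1 := by rw [ev2_lin2]; push_cast; ring
/-- `t+n+2`. -/
private theorem l112 : ev2 (lin2 1 1 2) n t = t + n + 2 := by rw [ev2_lin2]; push_cast; ring
/-- `t+n+3`. -/
private theorem l113 : ev2 (lin2 1 1 3) n t = t + n + 3 := by rw [ev2_lin2]; push_cast; ring
/-- `t+2n+j`. -/
private theorem l21 (j : ℤ) : ev2 (lin2 2 1 j) n t = t + 2 * n + j := by rw [ev2_lin2]; push_cast; ring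
/-- `t+3n+j`. -/
private theorem l31 (j : ℤ) : ev2 (lin2 3 1 j) n t = t + 3 * n + j := by rw [ev2_lin2]; push_cast; ring
/-- `2t+3n+j`. -/
private theorem l32 (j : ℤ) : ev2 (lin2 3 2 j) n t = 2 * t + 3 * n + j := by rw [ev2_lin2]; push_cast; ring
/-- `t+1`. -/
private theorem l011 : ev2 (lin2 0 1 1) n t = t + 1 := by rw [ev2_lin2]; push_cast; ring

end bookkeeping

/-- `(x)_2` (small Pochhammer products, explicitly). -/
private theorem poch_two' (x : ℚ) : BallRivoal.poch x 2 = x * (x + 1) := by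
  simp [BallRivoal.poch, prod_range_succ]
/-- `(x)_3`. -/
private theorem poch_three' (x : ℚ) : BallRivoal.poch x 3 = x * (x + 1) * (x + 2) := by
  simp [BallRivoal.poch, prod_range_succ]
/-- `(x)_4`. -/
private theorem poch_four' (x : ℚ) : BallRivoal.poch x 4 = x * (x + 1) * (x + 2) * (x + 3) := by
  simp [BallRivoal.poch, prod_range_succ]
/-- `(x)_6`. -/
private theorem poch_six' (x : ℚ) :
    BallRivoal.poch x 6 = x * (x + 1) * (x + 2) * (x + 3) * (x + 4) * (x + 5) := by
  simp [BallRivoal.poch, prod_range_succ]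
/-- `(x)_7`. -/
private theorem poch_seven' (x : ℚ) :
    BallRivoal.poch x 7 = x * (x + 1) * (x + 2) * (x + 3) * (x + 4) * (x + 5) * (x + 6) := by
  simp [BallRivoal.poch, prod_range_succ]
/-- `(x)_9`. -/
private theorem poch_nine' (x : ℚ) :
    BallRivoal.poch x 9 = x * (x + 1) * (x + 2) * (x + 3) * (x + 4) * (x + 5) * (x + 6) * (x + 7) * (x + 8) := by
  simp [BallRivoal.poch, prod_range_succ]

/-- The common factor `R̄ = (t+1)_n (t+2n+2)_n / ((t+n+1)_{n+1}⁶ ((t+2n+2)⋯(t+2n+8))⁷ (t+1))`. -/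
def Rbar (n t : ℚ) (k : ℕ) : ℚ :=
  BallRivoal.poch (t + 1) k * BallRivoal.poch (t + 2 * n + 2) k /
    (BallRivoal.poch (t + n + 1) (k + 1) ^ 6 *
      (ev2 (lin2 2 1 2) n t * ev2 (lin2 2 1 3) n t * ev2 (lin2 2 1 4) n t * ev2 (lin2 2 1 5) n t *
        ev2 (lin2 2 1 6) n t * ev2 (lin2 2 1 7) n t * ev2 (lin2 2 1 8) n t) ^ 7 * ev2 (lin2 0 1 1) n t)

/-- `R_n = R̄·N₀·B`. -/
theorem term0 (n t : ℕ) : pfEval (3 * n) 6 (pfData (bRay n)) t = Rbar n t n * (ev2 symN0 n t * ev2 symB n t) := by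
  have ht : ∀ p, p ≤ 3 * n → (t : ℚ) + p + 1 ≠ 0 := fun p _ => by positivity
  rw [pfEval_ray n t ht, poch_ray_split]
  simp only [Rbar, symN0, symB, ev2_mul2, ev2_pow2, l21, l32, l011]
  have hA : BallRivoal.poch ((t : ℚ) + 1) n ≠ 0 := (poch_pos (by positivity) _).ne'
  have hC : BallRivoal.poch ((t : ℚ) + 2 * n + 2) n ≠ 0 := (poch_pos (by positivity) _).ne'
  have hE : BallRivoal.poch ((t : ℚ) + n + 1) (n + 1) ≠ 0 := (poch_pos (by positivity) _).ne'
  push_cast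
  field_simp

/-- `R_{n+1} = R̄·N₁·B`. -/
theorem term1 (n t : ℕ) :
    pfEval (3 * (n + 1)) 6 (pfData (bRay (n + 1))) t = Rbar n t n * (ev2 symN1 n t * ev2 symB n t) := by
  have ht : ∀ p, p ≤ 3 * (n + 1) → (t : ℚ) + p + 1 ≠ 0 := fun p _ => by positivity
  rw [pfEval_ray (n + 1) t ht, poch_ray_split]
  -- the three blocks of `(t+1)_{3n+4}` and the numerator blocks, in atoms
  have e1 : BallRivoal.poch ((t : ℚ) + 1) (n + 1) = BallRivoal.poch ((t : ℚ) + 1) n * ((t : ℚ) + n + 1) := by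
    rw [poch_succ_right]; ring
  have e2 : BallRivoal.poch ((t : ℚ) + 2 * ((n + 1 : ℕ) : ℚ) + 2) (n + 1) * (((t : ℚ) + 2 * n + 2) * ((t : ℚ) + 2 * n + 3)) =
      BallRivoal.poch ((t : ℚ) + 2 * n + 2) n * (((t : ℚ) + 3 * n + 2) * ((t : ℚ) + 3 * n + 3) * ((t : ℚ) + 3 * n + 4)) := by
    have h1 := poch_add ((t : ℚ) + 2 * n + 2) 2 (n + 1)
    have h2 := poch_add ((t : ℚ) + 2 * n + 2) n 3
    rw [show 2 + (n + 1) = n + 3 by ring] at h1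
    rw [poch_two'] at h1; rw [poch_three'] at h2
    have : BallRivoal.poch ((t : ℚ) + 2 * ((n + 1 : ℕ) : ℚ) + 2) (n + 1) =
        BallRivoal.poch ((t : ℚ) + 2 * n + 2 + (2 : ℕ)) (n + 1) := by congr 1; push_cast; ring
    rw [this]; push_cast at h1 h2 ⊢; linear_combination -h1 + h2
  have e3 : BallRivoal.poch ((t : ℚ) + ((n + 1 : ℕ) : ℚ) + 1) (n + 1 + 1) * ((t : ℚ) + n + 1) =
      BallRivoal.poch ((t : ℚ) + n + 1) (n + 1) * (((t : ℚ) + 2 * n + 2) * ((t : ℚ) + 2 * n + 3)) := by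
    have h1 := poch_succ_left ((t : ℚ) + n + 1) (n + 2)
    have h2 := poch_add ((t : ℚ) + n + 1) (n + 1) 2
    rw [show n + 2 = (n + 1) + 1 + 0 + 0 by ring] at h1
    rw [poch_two'] at h2
    have : BallRivoal.poch ((t : ℚ) + ((n + 1 : ℕ) : ℚ) + 1) (n + 1 + 1) =
        BallRivoal.poch ((t : ℚ) + n + 1 + 1) (n + 1 + 1) := by congr 1; push_cast; ring
    rw [this]; simp only [Nat.add_zero] at h1; push_cast at h1 h2 ⊢; linear_combination -h1 + h2
  simp only [Rbar, symN1, symB, ev2_mul2, ev2_pow2, l111, l21, l31, l32, l011]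
  have hA : BallRivoal.poch ((t : ℚ) + 1) n ≠ 0 := (poch_pos (by positivity) _).ne'
  have hC : BallRivoal.poch ((t : ℚ) + 2 * n + 2) n ≠ 0 := (poch_pos (by positivity) _).ne'
  have hE : BallRivoal.poch ((t : ℚ) + n + 1) (n + 1) ≠ 0 := (poch_pos (by positivity) _).ne'
  have hv2 : ((t : ℚ) + 2 * n + 2) ≠ 0 := by positivity
  have hv3 : ((t : ℚ) + 2 * n + 3) ≠ 0 := by positivity
  have hu1 : ((t : ℚ) + n + 1) ≠ 0 := by positivity
  -- solve for the shifted blocks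
  have e2' : BallRivoal.poch ((t : ℚ) + 2 * ((n + 1 : ℕ) : ℚ) + 2) (n + 1) =
      BallRivoal.poch ((t : ℚ) + 2 * n + 2) n * (((t : ℚ) + 3 * n + 2) * ((t : ℚ) + 3 * n + 3) * ((t : ℚ) + 3 * n + 4)) /
        (((t : ℚ) + 2 * n + 2) * ((t : ℚ) + 2 * n + 3)) := by
    rw [eq_div_iff (mul_ne_zero hv2 hv3), e2]
  have e3' : BallRivoal.poch ((t : ℚ) + ((n + 1 : ℕ) : ℚ) + 1) (n + 1 + 1) =
      BallRivoal.poch ((t : ℚ) + n + 1) (n + 1) * (((t : ℚ) + 2 * n + 2) * ((t : ℚ) + 2 * n + 3)) / ((t : ℚ) + n + 1) := by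
    rw [eq_div_iff hu1, e3]
  rw [e1, e2', e3']
  push_cast
  field_simp
  ring

/-- Two splittings of one Pochhammer product: `(x)_a (x+a)_b = (x)_c (x+c)_d` when `a + b = c + d`. -/
theorem poch_split_comm (x : ℚ) {a b c d : ℕ} (h : a + b = c + d) :
    BallRivoal.poch x a * BallRivoal.poch (x + a) b = BallRivoal.poch x c * BallRivoal.poch (x + c) d := by
  rw [← poch_add, ← poch_add, h]

/-- `R_{n+2} = R̄·N₂·B`. -/
theorem term2 (n t : ℕ) :
    pfEval (3 * (n + 2)) 6 (pfData (bRay (n + 2))) t = Rbar n t n * (ev2 symN2 n t * ev2 symB n t) := by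
  have ht : ∀ p, p ≤ 3 * (n + 2) → (t : ℚ) + p + 1 ≠ 0 := fun p _ => by positivity
  rw [pfEval_ray (n + 2) t ht, poch_ray_split]
  set A := BallRivoal.poch ((t : ℚ) + 1) n with hAdef
  set C := BallRivoal.poch ((t : ℚ) + 2 * n + 2) n with hCdef
  set E := BallRivoal.poch ((t : ℚ) + n + 1) (n + 1) with hEdef
  have e1 : BallRivoal.poch ((t : ℚ) + 1) (n + 2) = A * (((t : ℚ) + n + 1) * ((t : ℚ) + n + 2)) := by
    rw [hAdef, poch_add, poch_two']; ring
  have e2 : BallRivoal.poch ((t : ℚ) + 2 * ((n + 2 : ℕ) : ℚ) + 2) (n + 2) *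
      (((t : ℚ) + 2 * n + 2) * ((t : ℚ) + 2 * n + 3) * ((t : ℚ) + 2 * n + 4) * ((t : ℚ) + 2 * n + 5)) =
      C * (((t : ℚ) + 3 * n + 2) * ((t : ℚ) + 3 * n + 3) * ((t : ℚ) + 3 * n + 4) * ((t : ℚ) + 3 * n + 5) *
        ((t : ℚ) + 3 * n + 6) * ((t : ℚ) + 3 * n + 7)) := by
    have h := poch_split_comm ((t : ℚ) + 2 * n + 2) (a := 4) (b := n + 2) (c := n) (d := 6) (by ring)
    rw [poch_four', poch_six', ← hCdef] at h
    have : BallRivoal.poch ((t : ℚ) + 2 * ((n + 2 : ℕ) : ℚ) + 2) (n + 2) =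
        BallRivoal.poch ((t : ℚ) + 2 * n + 2 + (4 : ℕ)) (n + 2) := by congr 1; push_cast; ring
    rw [this]; push_cast at h ⊢; linear_combination h
  have e3 : BallRivoal.poch ((t : ℚ) + ((n + 2 : ℕ) : ℚ) + 1) (n + 2 + 1) * (((t : ℚ) + n + 1) * ((t : ℚ) + n + 2)) =
      E * (((t : ℚ) + 2 * n + 2) * ((t : ℚ) + 2 * n + 3) * ((t : ℚ) + 2 * n + 4) * ((t : ℚ) + 2 * n + 5)) := by
    have h := poch_split_comm ((t : ℚ) + n + 1) (a := 2) (b := n + 3) (c := n + 1) (d := 4) (by ring)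
    rw [poch_two', poch_four', ← hEdef] at h
    have : BallRivoal.poch ((t : ℚ) + ((n + 2 : ℕ) : ℚ) + 1) (n + 2 + 1) =
        BallRivoal.poch ((t : ℚ) + n + 1 + (2 : ℕ)) (n + 3) := by congr 1; push_cast; ring
    rw [this]; push_cast at h ⊢; linear_combination h
  simp only [Rbar, symN2, symB, ev2_mul2, ev2_pow2, l111, l112, l21, l31, l32, l011]
  rw [← hAdef, ← hCdef, ← hEdef]
  have hA : A ≠ 0 := (poch_pos (by positivity) _).ne'
  have hC : C ≠ 0 := (poch_pos (by positivity) _).ne'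
  have hE : E ≠ 0 := (poch_pos (by positivity) _).ne'
  have hv : ((t : ℚ) + 2 * n + 2) * ((t : ℚ) + 2 * n + 3) * ((t : ℚ) + 2 * n + 4) * ((t : ℚ) + 2 * n + 5) ≠ 0 := by
    positivity
  have hu : ((t : ℚ) + n + 1) * ((t : ℚ) + n + 2) ≠ 0 := by positivity
  rw [e1, (eq_div_iff hv).2 e2, (eq_div_iff hu).2 e3]
  push_cast
  field_simp
  ring

/-- `R_{n+3} = R̄·N₃·B`. -/
theorem term3 (n t : ℕ) :
    pfEval (3 * (n + 3)) 6 (pfData (bRay (n + 3))) t = Rbar n t n * (ev2 symN3 n t * ev2 symB n t) := by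
  have ht : ∀ p, p ≤ 3 * (n + 3) → (t : ℚ) + p + 1 ≠ 0 := fun p _ => by positivity
  rw [pfEval_ray (n + 3) t ht, poch_ray_split]
  set A := BallRivoal.poch ((t : ℚ) + 1) n with hAdef
  set C := BallRivoal.poch ((t : ℚ) + 2 * n + 2) n with hCdef
  set E := BallRivoal.poch ((t : ℚ) + n + 1) (n + 1) with hEdef
  have e1 : BallRivoal.poch ((t : ℚ) + 1) (n + 3) = A * (((t : ℚ) + n + 1) * ((t : ℚ) + n + 2) * ((t : ℚ) + n + 3)) := by
    rw [hAdef, poch_add, poch_three']; ring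
  have e2 : BallRivoal.poch ((t : ℚ) + 2 * ((n + 3 : ℕ) : ℚ) + 2) (n + 3) *
      (((t : ℚ) + 2 * n + 2) * ((t : ℚ) + 2 * n + 3) * ((t : ℚ) + 2 * n + 4) * ((t : ℚ) + 2 * n + 5) *
        ((t : ℚ) + 2 * n + 6) * ((t : ℚ) + 2 * n + 7)) =
      C * (((t : ℚ) + 3 * n + 2) * ((t : ℚ) + 3 * n + 3) * ((t : ℚ) + 3 * n + 4) * ((t : ℚ) + 3 * n + 5) *
        ((t : ℚ) + 3 * n + 6) * ((t : ℚ) + 3 * n + 7) * ((t : ℚ) + 3 * n + 8) * ((t : ℚ) + 3 * n + 9) *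
        ((t : ℚ) + 3 * n + 10)) := by
    have h := poch_split_comm ((t : ℚ) + 2 * n + 2) (a := 6) (b := n + 3) (c := n) (d := 9) (by ring)
    rw [poch_six', poch_nine', ← hCdef] at h
    have : BallRivoal.poch ((t : ℚ) + 2 * ((n + 3 : ℕ) : ℚ) + 2) (n + 3) =
        BallRivoal.poch ((t : ℚ) + 2 * n + 2 + (6 : ℕ)) (n + 3) := by congr 1; push_cast; ring
    rw [this]; push_cast at h ⊢; linear_combination h
  have e3 : BallRivoal.poch ((t : ℚ) + ((n + 3 : ℕ) : ℚ) + 1) (n + 3 + 1) *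
      (((t : ℚ) + n + 1) * ((t : ℚ) + n + 2) * ((t : ℚ) + n + 3)) =
      E * (((t : ℚ) + 2 * n + 2) * ((t : ℚ) + 2 * n + 3) * ((t : ℚ) + 2 * n + 4) * ((t : ℚ) + 2 * n + 5) *
        ((t : ℚ) + 2 * n + 6) * ((t : ℚ) + 2 * n + 7)) := by
    have h := poch_split_comm ((t : ℚ) + n + 1) (a := 3) (b := n + 4) (c := n + 1) (d := 6) (by ring)
    rw [poch_three', poch_six', ← hEdef] at h
    have : BallRivoal.poch ((t : ℚ) + ((n + 3 : ℕ) : ℚ) + 1) (n + 3 + 1) =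
        BallRivoal.poch ((t : ℚ) + n + 1 + (3 : ℕ)) (n + 4) := by congr 1; push_cast; ring
    rw [this]; push_cast at h ⊢; linear_combination h
  simp only [Rbar, symN3, symB, ev2_mul2, ev2_pow2, l111, l112, l113, l21, l31, l32, l011]
  rw [← hAdef, ← hCdef, ← hEdef]
  have hA : A ≠ 0 := (poch_pos (by positivity) _).ne'
  have hC : C ≠ 0 := (poch_pos (by positivity) _).ne'
  have hE : E ≠ 0 := (poch_pos (by positivity) _).ne'
  have hv : ((t : ℚ) + 2 * n + 2) * ((t : ℚ) + 2 * n + 3) * ((t : ℚ) + 2 * n + 4) * ((t : ℚ) + 2 * n + 5) *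
      ((t : ℚ) + 2 * n + 6) * ((t : ℚ) + 2 * n + 7) ≠ 0 := by positivity
  have hu : ((t : ℚ) + n + 1) * ((t : ℚ) + n + 2) * ((t : ℚ) + n + 3) ≠ 0 := by positivity
  rw [e1, (eq_div_iff hv).2 e2, (eq_div_iff hu).2 e3]
  push_cast
  field_simp
  ring

/-- `G(t) = R̄·g(n,t)·B` for partial-fraction data `d` of `G`. -/
theorem termG (n t : ℕ) (d : ℕ → ℕ → ℚ)
    (hd : ∀ s : ℚ, (∀ p, p ≤ 3 * n + 6 → s + p + 1 ≠ 0) →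
      pfEval (3 * n + 6) 7 d s = (gPolyT n).eval s / BallRivoal.poch (s + 1) (3 * n + 7) ^ 7) :
    pfEval (3 * n + 6) 7 d t = Rbar n t n * (ev2 symG n t * ev2 symB n t) := by
  rw [hd _ (fun p _ => by positivity), eval_gPolyT]
  set A := BallRivoal.poch ((t : ℚ) + 1) n with hAdef
  set C := BallRivoal.poch ((t : ℚ) + 2 * n + 2) n with hCdef
  set E := BallRivoal.poch ((t : ℚ) + n + 1) (n + 1) with hEdef
  have eC : BallRivoal.poch ((t : ℚ) + (2 * n + 2)) n = C := by rw [hCdef]; congr 1; ring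
  have eE : BallRivoal.poch ((t : ℚ) + (n + 1)) (n + 1) = E := by rw [hEdef]; congr 1; ring
  have e4 : BallRivoal.poch ((t : ℚ) + (2 * n + 8)) n *
      (((t : ℚ) + 2 * n + 2) * ((t : ℚ) + 2 * n + 3) * ((t : ℚ) + 2 * n + 4) * ((t : ℚ) + 2 * n + 5) *
        ((t : ℚ) + 2 * n + 6) * ((t : ℚ) + 2 * n + 7)) =
      C * (((t : ℚ) + 3 * n + 2) * ((t : ℚ) + 3 * n + 3) * ((t : ℚ) + 3 * n + 4) * ((t : ℚ) + 3 * n + 5) *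
        ((t : ℚ) + 3 * n + 6) * ((t : ℚ) + 3 * n + 7)) := by
    have h := poch_split_comm ((t : ℚ) + 2 * n + 2) (a := 6) (b := n) (c := n) (d := 6) (by ring)
    rw [poch_six', poch_six', ← hCdef] at h
    have : BallRivoal.poch ((t : ℚ) + (2 * n + 8)) n = BallRivoal.poch ((t : ℚ) + 2 * n + 2 + (6 : ℕ)) n := by
      congr 1; push_cast; ring
    rw [this]; push_cast at h ⊢; linear_combination h
  have e5 : BallRivoal.poch ((t : ℚ) + 1) (3 * n + 7) =
      A * E * C * (((t : ℚ) + 3 * n + 2) * ((t : ℚ) + 3 * n + 3) * ((t : ℚ) + 3 * n + 4) * ((t : ℚ) + 3 * n + 5) *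
        ((t : ℚ) + 3 * n + 6) * ((t : ℚ) + 3 * n + 7)) := by
    rw [show 3 * n + 7 = (3 * n + 1) + 6 by ring, poch_add, poch_ray_split, poch_six', ← hAdef, ← hCdef, ← hEdef]
    push_cast; ring
  simp only [Rbar, symB, ev2_mul2, ev2_pow2, l21, l011]
  rw [← hAdef, ← hCdef, ← hEdef]
  have hA : A ≠ 0 := (poch_pos (by positivity) _).ne'
  have hC : C ≠ 0 := (poch_pos (by positivity) _).ne'
  have hE : E ≠ 0 := (poch_pos (by positivity) _).ne'
  have hv : ((t : ℚ) + 2 * n + 2) * ((t : ℚ) + 2 * n + 3) * ((t : ℚ) + 2 * n + 4) * ((t : ℚ) + 2 * n + 5) *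
      ((t : ℚ) + 2 * n + 6) * ((t : ℚ) + 2 * n + 7) ≠ 0 := by positivity
  rw [eC, eE, (eq_div_iff hv).2 e4, e5]
  push_cast
  field_simp

/-- `G(t+1) = R̄·g(n,t+1)·A` for partial-fraction data `d` of `G`. -/
theorem termG_succ (n t : ℕ) (d : ℕ → ℕ → ℚ)
    (hd : ∀ s : ℚ, (∀ p, p ≤ 3 * n + 6 → s + p + 1 ≠ 0) →
      pfEval (3 * n + 6) 7 d s = (gPolyT n).eval s / BallRivoal.poch (s + 1) (3 * n + 7) ^ 7) :
    pfEval (3 * n + 6) 7 d ((t : ℚ) + 1) = Rbar n t n * (ev2 symG n ((t : ℚ) + 1) * ev2 symA n t) := by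
  rw [hd _ (fun p _ => by positivity), eval_gPolyT]
  set A := BallRivoal.poch ((t : ℚ) + 1) n with hAdef
  set C := BallRivoal.poch ((t : ℚ) + 2 * n + 2) n with hCdef
  set E := BallRivoal.poch ((t : ℚ) + n + 1) (n + 1) with hEdef
  have e6 : BallRivoal.poch ((t : ℚ) + 1 + 1) n * ((t : ℚ) + 1) = A * ((t : ℚ) + n + 1) := by
    have h1 := poch_succ_left ((t : ℚ) + 1) n
    have h2 := poch_succ_right ((t : ℚ) + 1) n
    rw [← hAdef] at h2; linear_combination -h1 + h2
  have e7 : BallRivoal.poch ((t : ℚ) + 1 + (2 * n + 2)) n * ((t : ℚ) + 2 * n + 2) = C * ((t : ℚ) + 3 * n + 2) := by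
    have h1 := poch_succ_left ((t : ℚ) + 2 * n + 2) n
    have h2 := poch_succ_right ((t : ℚ) + 2 * n + 2) n
    rw [← hCdef] at h2
    rw [show (t : ℚ) + 1 + (2 * n + 2) = (t : ℚ) + 2 * n + 2 + 1 by ring]
    linear_combination -h1 + h2
  have e8 : BallRivoal.poch ((t : ℚ) + 1 + (n + 1)) (n + 1) * ((t : ℚ) + n + 1) = E * ((t : ℚ) + 2 * n + 2) := by
    have h1 := poch_succ_left ((t : ℚ) + n + 1) (n + 1)
    have h2 := poch_succ_right ((t : ℚ) + n + 1) (n + 1)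
    rw [← hEdef] at h2
    rw [show (t : ℚ) + 1 + (n + 1) = (t : ℚ) + n + 1 + 1 by ring]
    push_cast at h1 h2 ⊢; linear_combination -h1 + h2
  have e9 : BallRivoal.poch ((t : ℚ) + 1 + (2 * n + 8)) n *
      (((t : ℚ) + 2 * n + 2) * ((t : ℚ) + 2 * n + 3) * ((t : ℚ) + 2 * n + 4) * ((t : ℚ) + 2 * n + 5) *
        ((t : ℚ) + 2 * n + 6) * ((t : ℚ) + 2 * n + 7) * ((t : ℚ) + 2 * n + 8)) =
      C * (((t : ℚ) + 3 * n + 2) * ((t : ℚ) + 3 * n + 3) * ((t : ℚ) + 3 * n + 4) * ((t : ℚ) + 3 * n + 5) *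
        ((t : ℚ) + 3 * n + 6) * ((t : ℚ) + 3 * n + 7) * ((t : ℚ) + 3 * n + 8)) := by
    have h := poch_split_comm ((t : ℚ) + 2 * n + 2) (a := 7) (b := n) (c := n) (d := 7) (by ring)
    rw [poch_seven', poch_seven', ← hCdef] at h
    rw [show (t : ℚ) + 1 + (2 * n + 8) = (t : ℚ) + 2 * n + 2 + ((7 : ℕ) : ℚ) by push_cast; ring]
    push_cast at h ⊢; linear_combination h
  have e10 : BallRivoal.poch ((t : ℚ) + 1 + 1) (3 * n + 7) * ((t : ℚ) + 1) =
      A * E * C * (((t : ℚ) + 3 * n + 2) * ((t : ℚ) + 3 * n + 3) * ((t : ℚ) + 3 * n + 4) * ((t : ℚ) + 3 * n + 5) *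
        ((t : ℚ) + 3 * n + 6) * ((t : ℚ) + 3 * n + 7) * ((t : ℚ) + 3 * n + 8)) := by
    have h1 := poch_succ_left ((t : ℚ) + 1) (3 * n + 7)
    have h2 : BallRivoal.poch ((t : ℚ) + 1) (3 * n + 7 + 1) =
        A * E * C * (((t : ℚ) + 3 * n + 2) * ((t : ℚ) + 3 * n + 3) * ((t : ℚ) + 3 * n + 4) * ((t : ℚ) + 3 * n + 5) *
        ((t : ℚ) + 3 * n + 6) * ((t : ℚ) + 3 * n + 7) * ((t : ℚ) + 3 * n + 8)) := by
      rw [show 3 * n + 7 + 1 = (3 * n + 1) + 7 by ring, poch_add, poch_ray_split, poch_seven', ← hAdef, ← hCdef, ← hEdef]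
      push_cast; ring
    linear_combination -h1 + h2
  simp only [Rbar, symA, ev2_mul2, ev2_pow2, l111, l21, l31, l011]
  rw [← hAdef, ← hCdef, ← hEdef]
  have hA : A ≠ 0 := (poch_pos (by positivity) _).ne'
  have hC : C ≠ 0 := (poch_pos (by positivity) _).ne'
  have hE : E ≠ 0 := (poch_pos (by positivity) _).ne'
  have ht1 : ((t : ℚ) + 1) ≠ 0 := by positivity
  have hv2 : ((t : ℚ) + 2 * n + 2) ≠ 0 := by positivity
  have hu1 : ((t : ℚ) + n + 1) ≠ 0 := by positivity
  have hv : ((t : ℚ) + 2 * n + 2) * ((t : ℚ) + 2 * n + 3) * ((t : ℚ) + 2 * n + 4) * ((t : ℚ) + 2 * n + 5) *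
      ((t : ℚ) + 2 * n + 6) * ((t : ℚ) + 2 * n + 7) * ((t : ℚ) + 2 * n + 8) ≠ 0 := by positivity
  rw [(eq_div_iff ht1).2 e6, (eq_div_iff hv2).2 e7, (eq_div_iff hu1).2 e8, (eq_div_iff hv).2 e9,
    (eq_div_iff ht1).2 e10]
  push_cast
  field_simp

/-- **The telescoping identity of the ray at natural arguments**:
`Σ_i P_i(n) R_{n+i}(t) + G(t) − G(t+1) = 0` for partial-fraction data `d` of `G`. -/
theorem rec_identity_ray (n t : ℕ) (d : ℕ → ℕ → ℚ)
    (hd : ∀ s : ℚ, (∀ p, p ≤ 3 * n + 6 → s + p + 1 ≠ 0) →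
      pfEval (3 * n + 6) 7 d s = (gPolyT n).eval s / BallRivoal.poch (s + 1) (3 * n + 7) ^ 7) :
    ev1 symP0 n * pfEval (3 * n) 6 (pfData (bRay n)) t + ev1 symP1 n * pfEval (3 * (n + 1)) 6 (pfData (bRay (n + 1))) t
      + ev1 symP2 n * pfEval (3 * (n + 2)) 6 (pfData (bRay (n + 2))) t
      + ev1 symP3 n * pfEval (3 * (n + 3)) 6 (pfData (bRay (n + 3))) t
      + pfEval (3 * n + 6) 7 d t - pfEval (3 * n + 6) 7 d ((t : ℚ) + 1) = 0 := by
  rw [term0, term1, term2, term3, termG n t d hd, termG_succ n t d hd]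
  linear_combination (Rbar n t n) * gosper_symray n t

end Summit.KontsevichZagierPeriods.Zeta5Search.SymRay
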